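import Literature.NumberTheory.Transcendental.AyoubPeriodSeriesKernel
import Literature.NumberTheory.Transcendental.AyoubPeriodSeriesProofs
import Literature.NumberTheory.Transcendental.LindemannWeierstrassProofs
import Mathlib.RingTheory.Algebraic.Integral
import HarnessLib

/-!
# Ayoub's Théorème 1.1 (kernel of term-by-term integration, `π` algebraic over `k`) FROM Théorème 1.11

Proofs only (no definition, no named fact), on top of
`Literature/NumberTheory/Transcendental/AyoubPeriodSeries.lean` (the objects of J. Ayoub, *La version
relative de la conjecture des périodes de Kontsevich–Zagier revisitée*, note, Univ. Zürich =
Tohoku Math. J. (2) 71 (2019) 465–485, `AyoubRelKZRevisited`, §1.1: `Oan σ = 𝒪_{k-alg}(𝔻̄^∞)`,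
`intC = ∫_{[0,1]^∞}`, `OanDagger σ = 𝒪†_{k-alg}(𝔻̄^∞)`, `intCLaurent` = the map (2), the generators
`anGenerators σ` of types (a), (b), the `k`-span `kSpan σ`, the hypothesis `IsPiAlgebraicOver σ`, and
the named fact `ayoub_integration_injective_localized` = Théorème 1.11), its sibling
`AyoubPeriodSeriesKernel.lean` (`ayoub_generators_le_kernel_holds`: the span of the generators lies
in the kernel, for every `σ`) and `AyoubPeriodSeriesProofs.lean`.

## What is proved

`ayoub_kernel_piAlgebraic_of_localized`: **Théorème 1.11 implies Théorème 1.1.** If term-by-term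
integration `𝒫†(k, σ) = 𝒫†,eff(k, σ)[(2πi)⁻¹] → ℂ((ϖ))` is injective (the named fact
`ayoub_integration_injective_localized`, Théorème 1.11, which the note proves for EVERY complex
embedding `σ`), then for every `σ` along which `π` is algebraic over `k` the kernel of (2) on
`𝒪†_{k-alg}(𝔻̄^∞)` is exactly the `k`-span of the generators (a), (b) — the statement of
Théorème 1.1 (= Ann. of Math. 181 (2015) Thm. 4.25 with the hypothesis of the erratum, Remarque 1.3).

This is how the note itself places Théorème 1.1: "sous l'hypothèse que `π ∈ ℂ` est algébrique sur
`k`, le Théorème 1.1 équivaut à l'injectivité du morphisme à droite [de (6)]. En fait, on a le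
résultat suivant qui répare [5, Théorème 4.25] et généralise le Théorème 1.1. Théorème 1.11."
(§1.3, p. 4), the point being Notation 1.9 (iii): "Lorsque `π ∈ ℂ` est algébrique sur `k`,
`2πi ∈ 𝒫^{eff}(k, σ)` est un élément inversible et on a alors `𝒫†,eff(k, σ) = 𝒫†(k, σ)`."

## The argument (Notation 1.9 (iii) made explicit inside the Lean rendering)

Let `F ∈ 𝒪†` with `∫ F = 0`. Théorème 1.11 gives `N`, and `g ∈ 𝒪_{k-alg}(𝔻̄^∞)` in variables
disjoint from those of `F`, with `∫ g = u := (2πi)^N` and `g • F ∈ S := ⟨(a), (b)⟩_k`. Since `π`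
(hence `2πi`, hence `u`, hence `c := u⁻¹`) is algebraic over `k`, the CONSTANT series `c` is
algebraic over `k(z)`, so `f := c • g - 1 ∈ 𝒪_{k-alg}(𝔻̄^∞)` (no new variables, same polyradius),
`∫ f = c u - 1 = 0`, and `f` is disjoint from `F`: thus `f • F = c • (g • F) - F` is a type (b)
generator. Finally `S` is stable under multiplication by constants algebraic over `k`
(`c • (∂G/∂zᵢ - G|₁ + G|₀) = ∂(cG)/∂zᵢ - (cG)|₁ + (cG)|₀` with `cG ∈ 𝒪†`, and
`c • (f' • L) = (c f') • L`), so `F = c • (g • F) - f • F ∈ S`. The inclusion `S ⊆ ker` is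
`ayoub_generators_le_kernel_holds` (sibling file), for every `σ`.

Also recorded (last section): the hypothesis of Théorème 1.1 FAILS for `k = ℚ`
(`not_isPiAlgebraicOver_rat`) and for every field `k` algebraic over `ℚ`
(`not_isPiAlgebraicOver_of_isAlgebraic`), by Lindemann's theorem, discharged in the tree as
`Literature.NumberTheory.Transcendental.transcendental_pi_holds` — so over `k ⊆ ℚ̄` only
Théorème 1.11 applies (Remarque 1.3).

Algebraicity bookkeeping uses Mathlib's `IsAlgebraic.add/.mul/.neg/.pow/.inv` over the domains
`k`, `k[z]` (`MvPolynomial ℕ k`) and `k[z][ϖ]`, through the local algebra structures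
`σ.toAlgebra`, `(polyToCSeries σ).toAlgebra`, `(polyToCLaurent σ).toAlgebra`.
-/

noncomputable section

open Finsupp MvPowerSeries

namespace Literature.NumberTheory.Transcendental.AyoubRel

section PiAlgebraic

variable {k : Type} [Field k] (σ : k →+* ℂ)

/-! ### Constants algebraic over `k` along `σ` -/

/-- If `π` is algebraic over `k` (along `σ`), so is `((2πi)^N)⁻¹` (`i` is a root of `X² + 1`,
algebraic elements over a field form a field). [folklore] -/
theorem algebraic_inv_two_pi_I_pow (hπ : IsPiAlgebraicOver σ) (N : ℕ) :
    ∃ p : Polynomial k, p ≠ 0 ∧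
      Polynomial.eval₂ σ (((2 * Real.pi * Complex.I) ^ N)⁻¹ : ℂ) p = 0 := by
  letI : Algebra k ℂ := σ.toAlgebra
  have hpi : IsAlgebraic k (Real.pi : ℂ) := (isPiAlgebraicOver_iff_isAlgebraic σ).mp hπ
  have h2 : IsAlgebraic k (2 : ℂ) := by
    simpa using isAlgebraic_nat (R := k) (A := ℂ) 2
  have hI : IsAlgebraic k Complex.I := by
    refine IsIntegral.isAlgebraic ⟨Polynomial.X ^ 2 + Polynomial.C 1, ?_, ?_⟩
    · exact Polynomial.monic_X_pow_add_C 1 two_ne_zero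
    · simp [Polynomial.eval₂_add, Polynomial.eval₂_X_pow, Complex.I_sq]
  have hu : IsAlgebraic k ((2 * Real.pi * Complex.I) ^ N : ℂ) := ((h2.mul hpi).mul hI).pow N
  exact hu.inv

/-- A constant `c ∈ ℂ` algebraic over `k` is, as a constant power series, algebraic over `k(z)`
(the same polynomial, with coefficients pushed into `k[z]`). [folklore] -/
theorem isAlgebraicOverRatFunc_C {c : ℂ}
    (hc : ∃ p : Polynomial k, p ≠ 0 ∧ Polynomial.eval₂ σ c p = 0) :
    IsAlgebraicOverRatFunc σ (MvPowerSeries.C c : CSeries) := by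
  obtain ⟨p, hp, hpc⟩ := hc
  refine ⟨p.map (MvPolynomial.C : k →+* MvPolynomial ℕ k), ?_, ?_⟩
  · exact (Polynomial.map_ne_zero_iff (MvPolynomial.C_injective ℕ k)).mpr hp
  · rw [Polynomial.eval₂_map]
    have hcomp : (polyToCSeries σ).comp (MvPolynomial.C : k →+* MvPolynomial ℕ k) =
        (MvPowerSeries.C : ℂ →+* CSeries).comp σ := by
      refine RingHom.ext fun a => ?_
      simp [polyToCSeries, MvPolynomial.map_C, MvPolynomial.coe_C]
    rw [hcomp, ← Polynomial.hom_eval₂, hpc, map_zero]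

/-- `IsAlgebraicOverRatFunc σ` is Mathlib's `IsAlgebraic (MvPolynomial ℕ k)` for the algebra
structure on `ℂ[[z]]` given by `polyToCSeries σ`. [folklore] -/
theorem isAlgebraicOverRatFunc_iff_isAlgebraic (F : CSeries) :
    IsAlgebraicOverRatFunc σ F ↔
      @IsAlgebraic (MvPolynomial ℕ k) CSeries _ _ (polyToCSeries σ).toAlgebra F :=
  Iff.rfl

/-- Algebraic elements of `ℂ[[z]]` over `k(z)` are closed under addition. [folklore] -/
theorem IsAlgebraicOverRatFunc.add {F G : CSeries} (hF : IsAlgebraicOverRatFunc σ F)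
    (hG : IsAlgebraicOverRatFunc σ G) : IsAlgebraicOverRatFunc σ (F + G) := by
  letI : Algebra (MvPolynomial ℕ k) CSeries := (polyToCSeries σ).toAlgebra
  exact ((isAlgebraicOverRatFunc_iff_isAlgebraic σ F).mp hF).add
    ((isAlgebraicOverRatFunc_iff_isAlgebraic σ G).mp hG)

/-- Algebraic elements of `ℂ[[z]]` over `k(z)` are closed under negation. [folklore] -/
theorem IsAlgebraicOverRatFunc.neg {F : CSeries} (hF : IsAlgebraicOverRatFunc σ F) :
    IsAlgebraicOverRatFunc σ (-F) := by
  letI : Algebra (MvPolynomial ℕ k) CSeries := (polyToCSeries σ).toAlgebra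
  exact ((isAlgebraicOverRatFunc_iff_isAlgebraic σ F).mp hF).neg

/-- Algebraic elements of `ℂ[[z]]` over `k(z)` are closed under multiplication. [folklore] -/
theorem IsAlgebraicOverRatFunc.mul {F G : CSeries} (hF : IsAlgebraicOverRatFunc σ F)
    (hG : IsAlgebraicOverRatFunc σ G) : IsAlgebraicOverRatFunc σ (F * G) := by
  letI : Algebra (MvPolynomial ℕ k) CSeries := (polyToCSeries σ).toAlgebra
  exact ((isAlgebraicOverRatFunc_iff_isAlgebraic σ F).mp hF).mul
    ((isAlgebraicOverRatFunc_iff_isAlgebraic σ G).mp hG)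

/-- Scaling by a constant algebraic over `k` preserves algebraicity over `k(z)`. [folklore] -/
theorem IsAlgebraicOverRatFunc.smul {c : ℂ}
    (hc : ∃ p : Polynomial k, p ≠ 0 ∧ Polynomial.eval₂ σ c p = 0) {F : CSeries}
    (hF : IsAlgebraicOverRatFunc σ F) : IsAlgebraicOverRatFunc σ (c • F) := by
  rw [MvPowerSeries.smul_eq_C_mul]
  exact (isAlgebraicOverRatFunc_C σ hc).mul σ hF

/-! ### Closure properties of `𝒪_{k-alg}(𝔻̄^∞)` -/

omit [Field k] in
/-- Monotonicity of "depends only on `z₀, …, z_{m-1}`". [folklore] -/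
theorem DependsOnlyOnLT.mono {F : CSeries} {m n : ℕ} (h : DependsOnlyOnLT F m) (hmn : m ≤ n) :
    DependsOnlyOnLT F n :=
  fun a ⟨i, hi, hai⟩ => h a ⟨i, hmn.trans hi, hai⟩

/-- `𝒪_{k-alg}(𝔻̄^∞)` is stable under scaling by constants algebraic over `k`. [folklore] -/
theorem smul_mem_Oan {c : ℂ} (hc : ∃ p : Polynomial k, p ≠ 0 ∧ Polynomial.eval₂ σ c p = 0)
    {F : CSeries} (hF : F ∈ Oan σ) : c • F ∈ Oan σ := by
  obtain ⟨⟨m, hm⟩, ⟨r, hr, hs⟩, halg⟩ := hF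
  refine ⟨⟨m, fun a ha => ?_⟩, ⟨r, hr, ?_⟩, halg.smul σ hc⟩
  · rw [MvPowerSeries.coeff_smul, hm a ha, mul_zero]
  · refine (hs.mul_left ‖c‖).congr fun a => ?_
    rw [MvPowerSeries.coeff_smul, norm_mul, mul_assoc]

/-- `𝒪_{k-alg}(𝔻̄^∞)` is stable under negation. [folklore] -/
theorem neg_mem_Oan {F : CSeries} (hF : F ∈ Oan σ) : -F ∈ Oan σ := by
  obtain ⟨⟨m, hm⟩, ⟨r, hr, hs⟩, halg⟩ := hF
  refine ⟨⟨m, fun a ha => ?_⟩, ⟨r, hr, ?_⟩, halg.neg σ⟩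
  · rw [map_neg, hm a ha, neg_zero]
  · refine hs.congr fun a => ?_
    rw [map_neg, norm_neg]

/-- `𝒪_{k-alg}(𝔻̄^∞)` is stable under addition (take the smaller polyradius). [folklore] -/
theorem add_mem_Oan {F G : CSeries} (hF : F ∈ Oan σ) (hG : G ∈ Oan σ) : F + G ∈ Oan σ := by
  obtain ⟨⟨m, hm⟩, ⟨r, hr, hs⟩, halg⟩ := hF
  obtain ⟨⟨m', hm'⟩, ⟨r', hr', hs'⟩, halg'⟩ := hG
  refine ⟨⟨max m m', fun a ha => ?_⟩, ⟨min r r', lt_min hr hr', ?_⟩, halg.add σ halg'⟩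
  · rw [map_add, DependsOnlyOnLT.mono hm (le_max_left m m') a ha,
      DependsOnlyOnLT.mono hm' (le_max_right m m') a ha, add_zero]
  · have h0 : (0 : ℝ) ≤ min r r' := (lt_min hr hr').le.trans' zero_le_one |>.trans (le_refl _)
    refine Summable.of_nonneg_of_le (fun a => by positivity) (fun a => ?_) (hs.add hs')
    calc ‖MvPowerSeries.coeff a (F + G)‖ * min r r' ^ degree a
        ≤ (‖MvPowerSeries.coeff a F‖ + ‖MvPowerSeries.coeff a G‖) * min r r' ^ degree a := by
          rw [map_add]
          exact mul_le_mul_of_nonneg_right (norm_add_le _ _) (by positivity)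
      _ = ‖MvPowerSeries.coeff a F‖ * min r r' ^ degree a +
            ‖MvPowerSeries.coeff a G‖ * min r r' ^ degree a := add_mul _ _ _
      _ ≤ ‖MvPowerSeries.coeff a F‖ * r ^ degree a + ‖MvPowerSeries.coeff a G‖ * r' ^ degree a := by
          gcongr
          · exact min_le_left r r'
          · exact min_le_right r r'

/-- `𝒪_{k-alg}(𝔻̄^∞)` is stable under subtraction. [folklore] -/
theorem sub_mem_Oan {F G : CSeries} (hF : F ∈ Oan σ) (hG : G ∈ Oan σ) : F - G ∈ Oan σ := by
  rw [sub_eq_add_neg]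
  exact add_mem_Oan σ hF (neg_mem_Oan σ hG)

/-! ### Linearity of `∫` and of the type (a) operator -/

omit [Field k] in
/-- `∫ (c • F) = c · ∫ F` (unconditionally: `tsum` and constants commute in `ℂ`). [folklore] -/
theorem intC_smul (c : ℂ) (F : CSeries) : intC (c • F) = c * intC F := by
  rw [intC, intC, ← tsum_mul_left]
  refine tsum_congr fun a => ?_
  rw [MvPowerSeries.coeff_smul, mul_assoc]

omit [Field k] in
/-- `∫ (F - G) = ∫ F - ∫ G` for absolutely summable `F`, `G`. [folklore] -/
theorem intC_sub {F G : CSeries} (hF : Summable fun a : ℕ →₀ ℕ => ‖MvPowerSeries.coeff a F‖)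
    (hG : Summable fun a : ℕ →₀ ℕ => ‖MvPowerSeries.coeff a G‖) :
    intC (F - G) = intC F - intC G := by
  rw [intC, intC, intC, ← (summable_intC_integrand hF).tsum_sub (summable_intC_integrand hG)]
  refine tsum_congr fun a => ?_
  rw [map_sub, sub_mul]

omit [Field k] in
/-- `∂(c F)/∂zᵢ = c ∂F/∂zᵢ`. [folklore] -/
theorem pdz_smul (i : ℕ) (c : ℂ) (F : CSeries) : pdz i (c • F) = c • pdz i F := by
  ext a
  change ((a i : ℂ) + 1) * MvPowerSeries.coeff (a + Finsupp.single i 1) (c • F) =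
    c * (((a i : ℂ) + 1) * MvPowerSeries.coeff (a + Finsupp.single i 1) F)
  rw [MvPowerSeries.coeff_smul]
  ring

omit [Field k] in
/-- `(c F)|_{zᵢ = d} = c · F|_{zᵢ = d}`. [folklore] -/
theorem restrC_smul (i : ℕ) (d c : ℂ) (F : CSeries) : restrC i d (c • F) = c • restrC i d F := by
  ext a
  change (if a i = 0 then
      ∑' n : ℕ, MvPowerSeries.coeff (a + Finsupp.single i n) (c • F) * d ^ n else 0) =
    c * (if a i = 0 then ∑' n : ℕ, MvPowerSeries.coeff (a + Finsupp.single i n) F * d ^ n else 0)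
  split_ifs
  · rw [← tsum_mul_left]
    refine tsum_congr fun n => ?_
    rw [MvPowerSeries.coeff_smul, mul_assoc]
  · rw [mul_zero]

omit [Field k] in
/-- The type (a) operator is `ℂ`-linear: `relAC i (c F) = c · relAC i F`. [folklore] -/
theorem relAC_smul (i : ℕ) (c : ℂ) (F : CSeries) : relAC i (c • F) = c • relAC i F := by
  simp only [relAC, pdz_smul, restrC_smul, smul_sub, smul_add]

/-! ### `𝒪†_{k-alg}(𝔻̄^∞)`, the generators and their `k`-span under algebraic constants -/

/-- `k[z][ϖ] → ℂ[[z]]((ϖ))` on the constants of `k`: `a ↦` the constant Laurent series `σ a`.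
[folklore] -/
theorem polyToCLaurent_C_C (a : k) :
    polyToCLaurent σ (Polynomial.C (MvPolynomial.C a)) =
      HahnSeries.C (MvPowerSeries.C (σ a) : CSeries) := by
  rw [polyToCLaurent_C]
  congr 1
  simp [polyToCSeries, MvPolynomial.map_C, MvPolynomial.coe_C]

/-- `𝒪†_{k-alg}(𝔻̄^∞)` is stable under scaling by constants algebraic over `k` (coefficientwise
for membership in `𝒪_{k-alg}(𝔻̄^∞)`; for algebraicity over `k(z, ϖ)`, `c • G = C(c) · G` is a
product of algebraic elements over the domain `k[z][ϖ]`). [folklore] -/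
theorem smul_mem_OanDagger {c : ℂ} (hc : ∃ p : Polynomial k, p ≠ 0 ∧ Polynomial.eval₂ σ c p = 0)
    {G : LaurentSeries CSeries} (hG : G ∈ OanDagger σ) : c • G ∈ OanDagger σ := by
  refine ⟨fun r => ?_, ?_⟩
  · rw [HahnSeries.coeff_smul]
    exact smul_mem_Oan σ hc (hG.1 r)
  · letI : Algebra (Polynomial (MvPolynomial ℕ k)) (LaurentSeries CSeries) :=
      (polyToCLaurent σ).toAlgebra
    have hG' : IsAlgebraic (Polynomial (MvPolynomial ℕ k)) G := hG.2
    have hC : IsAlgebraic (Polynomial (MvPolynomial ℕ k))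
        (HahnSeries.C (MvPowerSeries.C c : CSeries) : LaurentSeries CSeries) := by
      obtain ⟨p, hp, hpc⟩ := hc
      refine ⟨p.map ((Polynomial.C : MvPolynomial ℕ k →+* Polynomial (MvPolynomial ℕ k)).comp
        (MvPolynomial.C : k →+* MvPolynomial ℕ k)), ?_, ?_⟩
      · have hinj : Function.Injective
            ((Polynomial.C : MvPolynomial ℕ k →+* Polynomial (MvPolynomial ℕ k)).comp
              (MvPolynomial.C : k →+* MvPolynomial ℕ k)) :=
          fun a b hab => MvPolynomial.C_injective ℕ k (Polynomial.C_injective hab)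
        exact (Polynomial.map_ne_zero_iff hinj).mpr hp
      · rw [Polynomial.aeval_def, Polynomial.eval₂_map]
        have hcomp : (algebraMap (Polynomial (MvPolynomial ℕ k)) (LaurentSeries CSeries)).comp
            ((Polynomial.C : MvPolynomial ℕ k →+* Polynomial (MvPolynomial ℕ k)).comp
              (MvPolynomial.C : k →+* MvPolynomial ℕ k)) =
            ((HahnSeries.C : CSeries →+* LaurentSeries CSeries).comp
              (MvPowerSeries.C : ℂ →+* CSeries)).comp σ := by
          refine RingHom.ext fun a => ?_
          change polyToCLaurent σ (Polynomial.C (MvPolynomial.C a)) = _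
          rw [polyToCLaurent_C_C]
          rfl
        rw [hcomp]
        have key := Polynomial.hom_eval₂ p σ
          ((HahnSeries.C : CSeries →+* LaurentSeries CSeries).comp
            (MvPowerSeries.C : ℂ →+* CSeries)) c
        rw [hpc, map_zero] at key
        exact key.symm
    have hmul := hC.mul hG'
    have heq : (HahnSeries.C (MvPowerSeries.C c : CSeries) : LaurentSeries CSeries) * G = c • G := by
      rw [HahnSeries.C_mul_eq_smul]
      apply HahnSeries.ext
      funext r
      rw [HahnSeries.coeff_smul, HahnSeries.coeff_smul, smul_eq_mul, MvPowerSeries.smul_eq_C_mul]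
    rw [heq] at hmul
    exact hmul

/-- The generators (a), (b) are stable under scaling by constants algebraic over `k`:
`c • (∂G/∂zᵢ - G|₁ + G|₀) = ∂(cG)/∂zᵢ - (cG)|₁ + (cG)|₀`, `c • (f • L) = (c f) • L`.
[cite: AyoubRelKZRevisited, Notation 1.9 (iii)] -/
theorem smul_mem_anGenerators {c : ℂ}
    (hc : ∃ p : Polynomial k, p ≠ 0 ∧ Polynomial.eval₂ σ c p = 0)
    {s : LaurentSeries CSeries} (hs : s ∈ anGenerators σ) : c • s ∈ anGenerators σ := by
  rcases hs with ⟨G, hG, i, rfl⟩ | ⟨f, hf, hf0, L, hL, hdisj, rfl⟩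
  · refine Or.inl ⟨c • G, smul_mem_OanDagger σ hc hG, i, ?_⟩
    apply HahnSeries.ext
    funext r
    rw [HahnSeries.coeff_smul, HahnSeries.map_coeff, HahnSeries.map_coeff, HahnSeries.coeff_smul]
    exact (relAC_smul i c (G.coeff r)).symm
  · refine Or.inr ⟨c • f, smul_mem_Oan σ hc hf, by rw [intC_smul, hf0, mul_zero], L, hL,
      fun i hi => hdisj i ⟨?_, hi.2⟩, (smul_assoc c f L).symm⟩
    obtain ⟨a, ha, hne⟩ := hi.1
    exact ⟨a, ha, fun h0 => hne (by rw [MvPowerSeries.coeff_smul, h0, mul_zero])⟩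

/-- `kSpan σ S` is stable under addition. [folklore] -/
theorem kSpan_add {M : Type*} [AddCommGroup M] [Module ℂ M] {S : Set M} {x y : M}
    (hx : x ∈ kSpan σ S) (hy : y ∈ kSpan σ S) : x + y ∈ kSpan σ S := by
  obtain ⟨n, a, s, hs, rfl⟩ := hx
  obtain ⟨m, b, t, ht, rfl⟩ := hy
  refine ⟨n + m, Fin.append a b, Fin.append s t, fun j => ?_, ?_⟩
  · refine Fin.addCases (fun i => ?_) (fun i => ?_) j
    · rw [Fin.append_left]; exact hs i
    · rw [Fin.append_right]; exact ht i
  · rw [Fin.sum_univ_add]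
    simp only [Fin.append_left, Fin.append_right]

/-- `kSpan σ S` is stable under negation. [folklore] -/
theorem kSpan_neg {M : Type*} [AddCommGroup M] [Module ℂ M] {S : Set M} {x : M}
    (hx : x ∈ kSpan σ S) : -x ∈ kSpan σ S := by
  obtain ⟨n, a, s, hs, rfl⟩ := hx
  refine ⟨n, fun j => -a j, s, hs, ?_⟩
  rw [← Finset.sum_neg_distrib]
  refine Finset.sum_congr rfl fun j _ => ?_
  rw [map_neg, neg_smul]

/-- `kSpan σ S` is stable under subtraction. [folklore] -/
theorem kSpan_sub {M : Type*} [AddCommGroup M] [Module ℂ M] {S : Set M} {x y : M}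
    (hx : x ∈ kSpan σ S) (hy : y ∈ kSpan σ S) : x - y ∈ kSpan σ S := by
  rw [sub_eq_add_neg]
  exact kSpan_add σ hx (kSpan_neg σ hy)

/-- The `k`-span of the generators is stable under scaling by constants algebraic over `k`
(so it is a `k(c)`-subspace; with `c = (2πi)⁻¹` this is "`𝒫†,eff = 𝒫†` when `π` is algebraic
over `k`"). [cite: AyoubRelKZRevisited, Notation 1.9 (iii)] -/
theorem smul_mem_kSpan_anGenerators {c : ℂ}
    (hc : ∃ p : Polynomial k, p ≠ 0 ∧ Polynomial.eval₂ σ c p = 0)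
    {x : LaurentSeries CSeries} (hx : x ∈ kSpan σ (anGenerators σ)) :
    c • x ∈ kSpan σ (anGenerators σ) := by
  obtain ⟨n, a, s, hs, rfl⟩ := hx
  refine ⟨n, a, fun j => c • s j, fun j => smul_mem_anGenerators σ hc (hs j), ?_⟩
  rw [Finset.smul_sum]
  refine Finset.sum_congr rfl fun j _ => ?_
  rw [smul_smul, smul_smul, mul_comm]

/-! ### Théorème 1.11 ⟹ Théorème 1.1 -/

/-- **Ayoub, revisited note: Théorème 1.11 implies Théorème 1.1** (Notation 1.9 (iii) and the
sentence before Théorème 1.11, §1.3). Assume the named fact `ayoub_integration_injective_localized`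
(Théorème 1.11: term-by-term integration `𝒫†(k, σ) → ℂ((ϖ))` is injective, for every complex
embedding). Then for every field `k` of characteristic `0`, every `σ : k ↪ ℂ` along which `π` is
algebraic over `k`, and every `F ∈ 𝒪†_{k-alg}(𝔻̄^∞)`: `∫ F = 0 ∈ ℂ((ϖ))` iff `F` lies in the
`k`-span of the generators (a) `∂G/∂zᵢ - G|_{zᵢ=1} + G|_{zᵢ=0}` and (b) `f · L` — Théorème 1.1,
i.e. Ann. of Math. 181 (2015) Thm. 4.25 with the hypothesis restored by Remarque 1.3.
Proof: `⇐` is `ayoub_generators_le_kernel_holds`; for `⇒`, Théorème 1.11 gives `g` with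
`∫ g = (2πi)^N =: u` and `g • F` in the span, the constant `u⁻¹` is algebraic over `k`, so
`(u⁻¹ g - 1) • F` is a type (b) generator and `F = u⁻¹ • (g • F) - (u⁻¹ g - 1) • F`.
[cite: AyoubRelKZRevisited, Théorème 1.1, Notation 1.9 (iii), Théorème 1.11] -/
theorem ayoub_kernel_piAlgebraic_of_localized (h : ayoub_integration_injective_localized)
    (k : Type) [Field k] [CharZero k] (σ : k →+* ℂ) (hπ : IsPiAlgebraicOver σ)
    (F : LaurentSeries CSeries) (hF : F ∈ OanDagger σ) :
    intCLaurent F = 0 ↔ F ∈ kSpan σ (anGenerators σ) := by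
  refine ⟨fun h0 => ?_, ayoub_kernel_piAlgebraic_mpr k σ F⟩
  obtain ⟨N, g, hg, hdisj, hint, hS⟩ := h k σ F hF h0
  set u : ℂ := (2 * Real.pi * Complex.I) ^ N with hu
  have hu0 : u ≠ 0 := pow_ne_zero _ (mul_ne_zero (mul_ne_zero two_ne_zero
    (Complex.ofReal_ne_zero.mpr Real.pi_ne_zero)) Complex.I_ne_zero)
  have hc : ∃ p : Polynomial k, p ≠ 0 ∧ Polynomial.eval₂ σ u⁻¹ p = 0 :=
    algebraic_inv_two_pi_I_pow σ hπ N
  -- the type (b) generator `(u⁻¹ g - 1) • F`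
  have hcg : u⁻¹ • g ∈ Oan σ := smul_mem_Oan σ hc hg
  have hf : u⁻¹ • g - 1 ∈ Oan σ := sub_mem_Oan σ hcg (one_mem_Oan σ)
  have hf0 : intC (u⁻¹ • g - 1) = 0 := by
    rw [intC_sub (summable_norm_coeff_of_mem_Oan σ hcg)
      (summable_norm_coeff_of_mem_Oan σ (one_mem_Oan σ)), intC_smul, hint, intC_one,
      inv_mul_cancel₀ hu0, sub_self]
  have hfd : ∀ i, ¬ (UsesVar (u⁻¹ • g - 1) i ∧ UsesVarL F i) := by
    rintro i ⟨⟨a, ha, hne⟩, hL⟩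
    refine hdisj i ⟨⟨a, ha, fun hz => hne ?_⟩, hL⟩
    have ha0 : a ≠ 0 := by
      rintro rfl
      exact ha rfl
    rw [map_sub, MvPowerSeries.coeff_smul, hz, mul_zero, MvPowerSeries.coeff_one, if_neg ha0,
      sub_zero]
  have hy : (u⁻¹ • g - 1) • F ∈ kSpan σ (anGenerators σ) :=
    subset_kSpan σ _ (Or.inr ⟨_, hf, hf0, F, hF, hfd, rfl⟩)
  have hx : u⁻¹ • (g • F) ∈ kSpan σ (anGenerators σ) := smul_mem_kSpan_anGenerators σ hc hS
  have hrepr : F = u⁻¹ • (g • F) - (u⁻¹ • g - 1) • F := by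
    apply HahnSeries.ext
    funext r
    rw [HahnSeries.coeff_sub, HahnSeries.coeff_smul, HahnSeries.coeff_smul, HahnSeries.coeff_smul,
      smul_eq_mul, smul_eq_mul, sub_mul, one_mul, smul_mul_assoc, sub_sub_cancel]
  rw [hrepr]
  exact kSpan_sub σ hx hy

/-- Packaged form: Théorème 1.11 (the named fact) implies Théorème 1.1 in the exact shape of the
statement `∀ k σ, IsPiAlgebraicOver σ → ∀ F ∈ 𝒪†, ∫ F = 0 ↔ F ∈ ⟨(a), (b)⟩_k`.
[cite: AyoubRelKZRevisited, Théorème 1.1 and Théorème 1.11] -/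
theorem ayoub_kernel_eq_kSpan_of_localized (h : ayoub_integration_injective_localized) :
    ∀ (k : Type) [Field k] [CharZero k] (σ : k →+* ℂ), IsPiAlgebraicOver σ →
      ∀ F ∈ OanDagger σ, intCLaurent F = 0 ↔ F ∈ kSpan σ (anGenerators σ) :=
  fun k _ _ σ hπ F hF => ayoub_kernel_piAlgebraic_of_localized h k σ hπ F hF

/-! ### The hypothesis of Théorème 1.1 fails over `ℚ̄` (Lindemann) -/

/-- For `k = ℚ` the hypothesis of Théorème 1.1 is FALSE: `π ∈ ℂ` is not algebraic over `ℚ`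
(Lindemann 1882; the tree's discharged fact `transcendental_pi_holds`, transported along
`ℝ ⊂ ℂ`). [cite: AyoubRelKZRevisited, Remarque 1.3] -/
theorem not_isPiAlgebraicOver_rat : ¬ IsPiAlgebraicOver (algebraMap ℚ ℂ) := by
  rw [isPiAlgebraicOver_rat_iff]
  intro h
  have h' : IsAlgebraic ℚ Real.pi := by
    rw [show (Real.pi : ℂ) = algebraMap ℝ ℂ Real.pi from rfl,
      isAlgebraic_algebraMap_iff Complex.ofReal_injective] at h
    exact h
  exact transcendental_pi_holds h'

/-- For every field `k` ALGEBRAIC over `ℚ` and every embedding `σ : k →+* ℂ`, `π` is not algebraic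
over `k` along `σ` (transitivity of algebraicity down to `ℚ`, then Lindemann): Théorème 1.1 says
nothing over `k ⊆ ℚ̄`, where only Théorème 1.11 applies ("On ignore si [5, Théorèmes 3.27 et
4.25] sont vrais sans l'hypothèse que `π ∈ ℂ` est algébrique sur `k`").
[cite: AyoubRelKZRevisited, Remarque 1.3] -/
theorem not_isPiAlgebraicOver_of_isAlgebraic (k : Type) [Field k] [CharZero k]
    [Algebra.IsAlgebraic ℚ k] (σ : k →+* ℂ) : ¬ IsPiAlgebraicOver σ := by
  intro h
  letI : Algebra k ℂ := σ.toAlgebra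
  have hπ : IsAlgebraic k (Real.pi : ℂ) := (isPiAlgebraicOver_iff_isAlgebraic σ).mp h
  have hQ : IsAlgebraic ℚ (Real.pi : ℂ) := hπ.restrictScalars ℚ
  exact not_isPiAlgebraicOver_rat ((isPiAlgebraicOver_rat_iff).mpr hQ)

end PiAlgebraic

end Literature.NumberTheory.Transcendental.AyoubRel
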